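import Summits.ResolutionOfSingularities.ResolutionOfSingularities.Theorems.FrobeniusClosingSteerNoSingularCarrierStep
import Mathlib.RingTheory.Localization.AtPrime.Basic
import HarnessLib

/-!
# No singular carrier along a σ_top-steered run — part 3a: the BIRATIONAL branch
# ((N4) of res-L0-w41-plan-1 RULING 7 §σ2.20 «NORMALISED START», W4.1 crux `Steer`)

W4.1, crux `Steer` (stmt-ResolutionOfSingularities-16345), §σ2.20 (res-L0-w41-plan-1 RULING 7 2026-08-27T07:54:40Z):
(N4) `noSingularCarrier_along_run`. Parts 1–2 (`…NoSingularCarrier.lean` p514035, `…NoSingularCarrierStep.lean`):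
the carrier dichotomy at a stage; divisor steps are trivial and create no new carrier; the exceptional prime of a
step along a regular centre is regular. Here (Theses-free, def-free; the bodies of `IsLocalBlowupAlong`,
`IsExcParamAlong`, `IsStrictStepAlong`, `IsSigmaTopCentre`, `NormalAt`, `NoSingularCarrier` unfolded):

* `exists_eq_div_pow_of_mem_chart`, `exists_mul_eq_of_mem_locAtCentre_chart` — elements of the chart ring
  `R[P/x₀]` are `a/x₀^m`, `a ∈ R`, and elements of the local blowing up `R' = (R[P/x₀])_{centre}` satisfy
  `d · (b x₀^m) = a x₀^n` with `a, b ∈ R` and `b/x₀^n` a unit of `R'`;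
* `false_of_normalAt_of_carrier_off_exceptional` — **from a `NormalAt` stage, no carrier of the next stage has a
  prime factor `q` off the exceptional parameter**: with `R'` regular and `q ∤ x₀`, the local ring `R'_{(q)}` is the
  localisation of `R` at `Q₀ = R ∩ qR'` (birationality off the exceptional divisor), so `ht Q₀ = ht (q) = 1` and
  `Q₀ = (π)` (Auslander–Buchsbaum); the carrier `s' ^ p = G ^ p + (qH') ^ p U` gives `s ^ p = (xG + g) ^ p + q ^ p w`,
  a LOCAL Frobenius congruence `b ^ p s ^ p = a ^ p + π ^ p c` in `R` with `π ∤ b`, which the local–global input (N5)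
  (res-D-pv-007, BY NAME as the hypothesis `hN5`) turns into a carrier `(g₀, π, u₀)` of positive value at `R` —
  against `NormalAt`;
Part 3b (`…NoSingularCarrierRun.lean`): the one-step propagation `noSingularCarrier_of_normalAt_step` and the
induction `noSingularCarrier_along_run` = (N4).

OURS (the W4.1 engine; res-L0-w41-plan-1 RULING 7 (N4)/(N5); AI review weaker than expert review); nothing here is
attributed to [claim: Hironaka2017]. [cite: NovacoskiSpivakovsky2014, Def. 2.11] [cite: Matsumura1987, Thm. 20.3]
-/

noncomputable section

-- `Summit.<S>.<S>.…` duplicates the summit name by design (single-problem summit).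
set_option linter.dupNamespace false

open Polynomial IsLocalRing Literature.AlgebraicGeometry.Resolution

namespace Summit.ResolutionOfSingularities.ResolutionOfSingularities.Theorems.SwitchingDichotomy.NoSingularCarrier

variable {K : Type} [Field K]

/-! ## §1 Elements of the chart ring and of the local blowing up -/

/-- Elements of the chart ring `R[P/x₀] = R[y/x₀ : y ∈ P] ⊆ K` (`x₀ ∈ R` nonzero) are fractions `a / x₀^m` with
`a ∈ R`. [folklore] -/
theorem exists_eq_div_pow_of_mem_chart (R : Subring K) {P : Ideal R} {x₀ : K} (hx₀R : x₀ ∈ R) (hx₀ : x₀ ≠ 0)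
    {y : K} (hy : y ∈ Subring.closure ((R : Set K) ∪ (fun y : R => (y : K) / x₀) '' (P : Set R))) :
    ∃ a ∈ R, ∃ m : ℕ, y = a / x₀ ^ m := by
  induction hy using Subring.closure_induction with
  | mem z hz =>
    rcases hz with hz | ⟨y, -, rfl⟩
    · exact ⟨z, hz, 0, by simp⟩
    · exact ⟨y, y.2, 1, by simp⟩
  | zero => exact ⟨0, R.zero_mem, 0, by simp⟩
  | one => exact ⟨1, R.one_mem, 0, by simp⟩
  | add a b _ _ ha hb =>
    obtain ⟨a₁, ha₁, m, rfl⟩ := ha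
    obtain ⟨b₁, hb₁, n, rfl⟩ := hb
    refine ⟨a₁ * x₀ ^ n + b₁ * x₀ ^ m,
      R.add_mem (R.mul_mem ha₁ (R.pow_mem hx₀R n)) (R.mul_mem hb₁ (R.pow_mem hx₀R m)), m + n, ?_⟩
    field_simp
    ring
  | neg a _ ha =>
    obtain ⟨a₁, ha₁, m, rfl⟩ := ha
    exact ⟨-a₁, R.neg_mem ha₁, m, by rw [neg_div]⟩
  | mul a b _ _ ha hb =>
    obtain ⟨a₁, ha₁, m, rfl⟩ := ha
    obtain ⟨b₁, hb₁, n, rfl⟩ := hb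
    refine ⟨a₁ * b₁, R.mul_mem ha₁ hb₁, m + n, ?_⟩
    rw [pow_add, div_mul_div_comm]

/-- Elements `d` of the local blowing up `R' = (R[P/x₀])_{𝔪_O ∩ R[P/x₀]}` satisfy `d · (b x₀^m) = a x₀^n` in `K`
for some `a, b ∈ R`, `m, n ∈ ℕ`, where `b / x₀^n ∈ R[P/x₀]` has value `1` (so is a unit of `R'`). [folklore] -/
theorem exists_mul_eq_of_mem_locAtCentre_chart {O : ValuationSubring K} (R : Subring K) {P : Ideal R} {x₀ : K}
    (hx₀R : x₀ ∈ R) (hx₀ : x₀ ≠ 0) {d : K}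
    (hd : d ∈ locAtCentre (Subring.closure ((R : Set K) ∪ (fun y : R => (y : K) / x₀) '' (P : Set R))) O) :
    ∃ a ∈ R, ∃ b ∈ R, ∃ m n : ℕ,
      (b : K) / x₀ ^ n ∈ Subring.closure ((R : Set K) ∪ (fun y : R => (y : K) / x₀) '' (P : Set R)) ∧
      O.valuation ((b : K) / x₀ ^ n) = 1 ∧ d * (b * x₀ ^ m) = a * x₀ ^ n := by
  obtain ⟨y, hy, z, hz, hvz, rfl⟩ := mem_locAtCentre_iff.mp hd
  obtain ⟨a, ha, m, rfl⟩ := exists_eq_div_pow_of_mem_chart R hx₀R hx₀ hy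
  obtain ⟨b, hb, n, rfl⟩ := exists_eq_div_pow_of_mem_chart R hx₀R hx₀ hz
  refine ⟨a, ha, b, hb, m, n, hz, hvz, ?_⟩
  have hb0 : (b : K) ≠ 0 := by
    intro h
    rw [h, zero_div, map_zero] at hvz
    exact zero_ne_one hvz
  field_simp

/-! ## §2 From a `NormalAt` stage, no carrier off the exceptional prime -/

/-- **The birational branch** (RULING 7 (N4), «new height-one primes of `R'` off the exceptional one are birational
to height-one primes of `R`, where a LOCAL carrier is GLOBAL by (N5)»). Data: `R ⊆ K` regular local of
characteristic `p`, dominated by `O`; the local blowing up `R' = (R[P/x₀])_{centre}` of `R` along `P` in the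
chart of `x₀ ∈ P` (nonzero), with `R'` a regular local ring; one strict-transform step `s = x·s' + g` (`x, g ∈ R`),
`f = s ^ p ∈ R`; the body of strat-2's `NormalAt O R p s`; the local–global input (N5) at `R` in elementwise form
(`hN5`: a Frobenius congruence `b ^ p f = a ^ p + π ^ p c` with `π ∤ b` along a prime `π` globalises to
`f = g₀ ^ p + π ^ p u₀`). Then NO carrier `s' ^ p = G ^ p + H ^ p U` over `R'` has a prime factor `q ∣ H` with
`q ∤ x₀`. Proof: `R'_{(q)}` is the localisation of `R` at `Q₀ := R ∩ q R'` (every element of `R'` is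
`a x₀^n / (b x₀^m)` with `b x₀^m ∉ qR'`), so `ht Q₀ = ht (q) = 1`, `Q₀ = (π)` with `π` prime (UFD), and the image of
`f = (xG + g) ^ p + q ^ p·(x H/q) ^ p U` in `R'_{(q)} = R_{(π)}` is a local Frobenius congruence; clearing
denominators and (N5) give a carrier `(g₀, π, u₀)` of `s` at `R` with `v(π) < 1`, contradicting `NormalAt`.
OURS (W4.1 engine). [cite: Matsumura1987, Thm. 20.3] [cite: NovacoskiSpivakovsky2014, Def. 2.11] -/
theorem false_of_normalAt_of_carrier_off_exceptional (p : ℕ) [Fact p.Prime] [CharP K p]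
    (O : ValuationSubring K) {R R' : Subring K} [IsRegularLocalRing R] [IsRegularLocalRing R']
    (hval : ∀ a : R, a ∈ maximalIdeal R ↔ O.valuation (a : K) < 1)
    {P : Ideal R} {x₀ : K} (hx₀R : x₀ ∈ R) (hx₀0 : x₀ ≠ 0)
    (hR' : R' = locAtCentre (Subring.closure ((R : Set K) ∪ (fun y : R => (y : K) / x₀) '' (P : Set R))) O)
    (hRR' : R ≤ R')
    {s s' x g : K} (hxR : x ∈ R) (hg : g ∈ R) (hstep : s = x * s' + g) (hs : s ^ p ∈ R)
    (hN : ∀ g h u : K, g ∈ R → h ∈ R → u ∈ R → O.valuation h < 1 → s ^ p ≠ g ^ p + h ^ p * u)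
    (hN5 : ∀ π a b c : R, Prime π → ¬ π ∣ b → b ^ p * ⟨s ^ p, hs⟩ = a ^ p + π ^ p * c →
      ∃ g₀ u₀ : R, (⟨s ^ p, hs⟩ : R) = g₀ ^ p + π ^ p * u₀)
    {G H U : K} (hG : G ∈ R') (hH : H ∈ R') (hU : U ∈ R') (heq : s' ^ p = G ^ p + H ^ p * U)
    (q : R') (hq : Prime q) (hqH : q ∣ (⟨H, hH⟩ : R')) (hqx₀ : ¬ q ∣ (⟨x₀, hRR' hx₀R⟩ : R')) : False := by
  classical
  have hp : p.Prime := Fact.out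
  haveI : ExpChar K p := ExpChar.prime hp
  haveI : IsDomain R := inferInstance
  haveI : IsDomain R' := inferInstance
  haveI : UniqueFactorizationMonoid R := uniqueFactorizationMonoid_of_isRegularLocalRing R ‹_›
  -- the prime `(q)` of `R'` and its local ring `T`
  set Q₁ : Ideal R' := Ideal.span {q} with hQ₁def
  haveI hQ₁prime : Q₁.IsPrime := (Ideal.span_singleton_prime hq.ne_zero).mpr hq
  set T := Localization.AtPrime Q₁ with hTdef
  haveI : IsLocalRing T := IsLocalization.AtPrime.isLocalRing T Q₁
  let ψ : R' →+* T := algebraMap R' T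
  have hψinj : Function.Injective ψ :=
    IsLocalization.injective T (Ideal.primeCompl_le_nonZeroDivisors Q₁)
  let ι : R →+* R' := Subring.inclusion hRR'
  have hιinj : Function.Injective ι := Subring.inclusion_injective hRR'
  let φ : R →+* T := ψ.comp ι
  have hφinj : Function.Injective φ := hψinj.comp hιinj
  -- membership in `Q₁`, i.e. divisibility by `q`
  have hmemQ₁ : ∀ z : R', z ∈ Q₁ ↔ q ∣ z := fun z => by rw [hQ₁def, Ideal.mem_span_singleton]
  have hψmax : ∀ z : R', ψ z ∈ maximalIdeal T ↔ q ∣ z := fun z => by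
    rw [IsLocalization.AtPrime.to_map_mem_maximal_iff T Q₁ z, hmemQ₁]
  -- elements of `R[P/x₀]` of value one are units of `R'`; hence `q ∤ b·x₀^m` for such `b/x₀^n`
  have hx₀R' : x₀ ∈ R' := hRR' hx₀R
  have hunitC : ∀ z : K, z ∈ Subring.closure ((R : Set K) ∪ (fun y : R => (y : K) / x₀) '' (P : Set R)) →
      O.valuation z = 1 → ∃ hz : z ∈ R', IsUnit (⟨z, hz⟩ : R') := by
    intro z hzC hvz
    have hzT : z ∈ R' := by rw [hR']; exact le_locAtCentre _ O hzC
    have hzinv : z⁻¹ ∈ R' := by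
      rw [hR']
      exact inv_mem_locAtCentre (le_locAtCentre _ O hzC) hvz
    refine ⟨hzT, isUnit_iff_exists_inv.mpr ⟨⟨z⁻¹, hzinv⟩, Subtype.ext ?_⟩⟩
    exact mul_inv_cancel₀ (ne_zero_of_valuation_eq_one hvz)
  have hndvd : ∀ (b : K) (hb : b ∈ R) (m n : ℕ),
      (b : K) / x₀ ^ n ∈ Subring.closure ((R : Set K) ∪ (fun y : R => (y : K) / x₀) '' (P : Set R)) →
      O.valuation ((b : K) / x₀ ^ n) = 1 → ¬ q ∣ (⟨b * x₀ ^ m, R'.mul_mem (hRR' hb) (R'.pow_mem hx₀R' m)⟩ : R') := by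
    intro b hb m n hzC hvz hdvd
    obtain ⟨hzR', hzunit⟩ := hunitC _ hzC hvz
    -- `b x₀^m = (b/x₀^n) · x₀^(n+m)`
    have hfac : (⟨b * x₀ ^ m, R'.mul_mem (hRR' hb) (R'.pow_mem hx₀R' m)⟩ : R') =
        ⟨(b : K) / x₀ ^ n, hzR'⟩ * (⟨x₀, hx₀R'⟩ : R') ^ (n + m) := by
      apply Subtype.ext
      simp only [Subring.coe_mul, Subring.coe_pow]
      rw [pow_add]
      field_simp
    rw [hfac] at hdvd
    rcases hq.dvd_or_dvd hdvd with h1 | h2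
    · exact hq.not_unit (isUnit_of_dvd_unit h1 hzunit)
    · exact hqx₀ (hq.dvd_of_dvd_pow h2)
  -- decomposition of elements of `R'`
  have hdec : ∀ d : R', ∃ (a b : R) (m n : ℕ) (hden : ¬ q ∣ ι (b * ⟨x₀, hx₀R⟩ ^ m)),
      d * ι (b * ⟨x₀, hx₀R⟩ ^ m) = ι (a * ⟨x₀, hx₀R⟩ ^ n) := by
    intro d
    have hd : (d : K) ∈ locAtCentre
        (Subring.closure ((R : Set K) ∪ (fun y : R => (y : K) / x₀) '' (P : Set R))) O := hR' ▸ d.2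
    obtain ⟨a, ha, b, hb, m, n, hzC, hvz, hdeq⟩ := exists_mul_eq_of_mem_locAtCentre_chart R hx₀R hx₀0 hd
    have hιb : ι (⟨b, hb⟩ * ⟨x₀, hx₀R⟩ ^ m) =
        ⟨b * x₀ ^ m, R'.mul_mem (hRR' hb) (R'.pow_mem hx₀R' m)⟩ := Subtype.ext (by simp [ι])
    refine ⟨⟨a, ha⟩, ⟨b, hb⟩, m, n, ?_, Subtype.ext ?_⟩
    · rw [hιb]; exact hndvd b hb m n hzC hvz
    · simp [ι, Subring.coe_mul, hdeq]
  -- `T` is the localisation of `R` at `Q₀ := φ⁻¹ 𝔪_T`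
  letI : Algebra R T := φ.toAlgebra
  have hφalg : ∀ a : R, algebraMap R T a = ψ (ι a) := fun a => rfl
  set Q₀ : Ideal R := Ideal.comap φ (maximalIdeal T) with hQ₀def
  haveI hQ₀prime : Q₀.IsPrime := Ideal.comap_isPrime φ (maximalIdeal T)
  have hmemQ₀ : ∀ a : R, a ∈ Q₀ ↔ q ∣ ι a := fun a => by
    rw [hQ₀def, Ideal.mem_comap]; exact hψmax (ι a)
  haveI hloc : IsLocalization.AtPrime T Q₀ := by
    refine (isLocalization_iff _ _).mpr ⟨?_, ?_, ?_⟩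
    · rintro ⟨y, hy⟩
      have hy' : φ y ∉ maximalIdeal T := hy
      exact not_not.mp fun h => hy' ((IsLocalRing.mem_maximalIdeal _).mpr h)
    · intro z
      obtain ⟨⟨d, e⟩, hz⟩ := IsLocalization.surj Q₁.primeCompl z
      have he : ¬ q ∣ (e : R') := fun h => e.2 ((hmemQ₁ e).mpr h)
      obtain ⟨ad, bd, md, nd, hbd, hd⟩ := hdec d
      obtain ⟨ae, be, me, ne, hbe, he'⟩ := hdec e
      -- denominator `bd x₀^md · ae x₀^ne ∉ Q₀`, numerator `ad x₀^nd · be x₀^me`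
      have hden : bd * ⟨x₀, hx₀R⟩ ^ md * (ae * ⟨x₀, hx₀R⟩ ^ ne) ∉ Q₀ := by
        rw [hmemQ₀, map_mul]
        intro h
        rcases hq.dvd_or_dvd h with h1 | h2
        · exact hbd h1
        · rw [← he'] at h2
          rcases hq.dvd_or_dvd h2 with h3 | h4
          · exact he h3
          · exact hbe h4
      refine ⟨⟨ad * ⟨x₀, hx₀R⟩ ^ nd * (be * ⟨x₀, hx₀R⟩ ^ me), ⟨_, hden⟩⟩, ?_⟩
      change z * ψ (ι (bd * ⟨x₀, hx₀R⟩ ^ md * (ae * ⟨x₀, hx₀R⟩ ^ ne))) =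
        ψ (ι (ad * ⟨x₀, hx₀R⟩ ^ nd * (be * ⟨x₀, hx₀R⟩ ^ me)))
      rw [map_mul ι (bd * _), ← he', map_mul ι (ad * _), ← hd]
      simp only [map_mul ψ]
      -- `z · ψ e = ψ d`
      have hz' : z * ψ e = ψ d := hz
      linear_combination (ψ (ι (bd * ⟨x₀, hx₀R⟩ ^ md)) * ψ (ι (be * ⟨x₀, hx₀R⟩ ^ me))) * hz'
    · intro a b hab
      exact ⟨1, by rw [hφinj hab]⟩
  -- heights: `ht Q₀ = dim T = ht (q) = 1`, so `Q₀ = (π)` with `π` prime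
  have hT1 : ringKrullDim T = (1 : ℕ∞) := by
    rw [IsLocalization.AtPrime.ringKrullDim_eq_height Q₁ T,
      Ideal.height_span_singleton_eq_one_of_mem_nonZeroDivisors (mem_nonZeroDivisors_of_ne_zero hq.ne_zero)
        hq.not_unit]
  have hQ₀ht : Q₀.height = 1 := by
    have h := IsLocalization.AtPrime.ringKrullDim_eq_height Q₀ T
    rw [hT1] at h
    exact_mod_cast h.symm
  obtain ⟨π, hπQ₀, hπ⟩ := hQ₀prime.exists_mem_prime_of_ne_bot (Ideal.ne_bot_of_height_eq_one hQ₀ht)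
  have hQ₀π : Q₀ = Ideal.span {π} := Ideal.eq_span_singleton_of_height_eq_one hQ₀ht hπQ₀ hπ
  -- `𝔪_T = φ(Q₀) T = (φ π)`, so `ψ q = ε · φ π`
  have hmaxT : maximalIdeal T = Ideal.span {φ π} := by
    rw [← IsLocalization.AtPrime.map_eq_maximalIdeal Q₀ T, hQ₀π, Ideal.map_span, Set.image_singleton]
    rfl
  have hqmax : ψ q ∈ maximalIdeal T := (hψmax q).mpr (dvd_refl q)
  rw [hmaxT] at hqmax
  obtain ⟨ε, hε⟩ := Ideal.mem_span_singleton'.mp hqmax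
  -- the carrier of `s` over `R'`: `s ^ p = θ ^ p + q ^ p · w`
  obtain ⟨H', hH'⟩ := hqH
  set fR : R := ⟨s ^ p, hs⟩ with hfRdef
  set θ : R' := ⟨x * G + g, R'.add_mem (R'.mul_mem (hRR' hxR) hG) (hRR' hg)⟩ with hθdef
  set w : R' := (⟨x, hRR' hxR⟩ : R') ^ p * H' ^ p * ⟨U, hU⟩ with hwdef
  have hcarR' : ι fR = θ ^ p + q ^ p * w := by
    apply Subtype.ext
    have hHK : (H : K) = (q : K) * (H' : K) := by
      have e := congrArg Subtype.val hH'
      simpa [Subring.coe_mul] using e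
    simp only [ι, hθdef, hwdef, Subring.coe_mul, Subring.coe_pow, Subring.coe_add]
    change s ^ p = (x * G + g) ^ p + (q : K) ^ p * (x ^ p * (H' : K) ^ p * U)
    rw [hstep, add_pow_expChar (x * s') g p, add_pow_expChar (x * G) g p, mul_pow, mul_pow, heq, hHK]
    ring
  -- in `T`: `φ f = ψθ ^ p + (φ π) ^ p · (ε ^ p ψ w)`
  have hcarT : φ fR = ψ θ ^ p + φ π ^ p * (ε ^ p * ψ w) := by
    change ψ (ι fR) = _
    rw [hcarR', map_add, map_pow, map_mul, map_pow, ← hε]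
    ring
  -- clear denominators over `R`
  obtain ⟨⟨a₁, b₁⟩, h₁⟩ := IsLocalization.surj Q₀.primeCompl (ψ θ)
  obtain ⟨⟨a₂, b₂⟩, h₂⟩ := IsLocalization.surj Q₀.primeCompl (ε ^ p * ψ w)
  have h₁' : ψ θ * φ b₁ = φ a₁ := h₁
  have h₂' : ε ^ p * ψ w * φ b₂ = φ a₂ := h₂
  have hmemπ : ∀ a : R, a ∈ Q₀ ↔ π ∣ a := fun a => by
    constructor
    · intro h
      rw [hQ₀π] at h
      exact Ideal.mem_span_singleton.mp h
    · intro h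
      rw [hQ₀π]
      exact Ideal.mem_span_singleton.mpr h
  have hb₁ : ¬ π ∣ (b₁ : R) := fun h => b₁.2 ((hmemπ _).mpr h)
  have hb₂ : ¬ π ∣ (b₂ : R) := fun h => b₂.2 ((hmemπ _).mpr h)
  set b : R := b₁ * b₂ with hbdef
  have hb : ¬ π ∣ b := fun h => (hπ.dvd_or_dvd h).elim hb₁ hb₂
  have hcong : b ^ p * fR = (a₁ * b₂) ^ p + π ^ p * ((b₁ : R) ^ p * (b₂ : R) ^ (p - 1) * a₂) := by
    obtain ⟨k, hk⟩ : ∃ k, p = k + 1 := ⟨p - 1, by have := hp.one_le; omega⟩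
    apply hφinj
    simp only [map_mul, map_pow, map_add, hcarT, hbdef]
    rw [← h₁', ← h₂', hk, Nat.add_sub_cancel]
    ring
  -- (N5): a global carrier `(g₀, π, u₀)` at `R`, of positive value — contradiction with `NormalAt`
  obtain ⟨g₀, u₀, hglob⟩ := hN5 π (a₁ * b₂) b _ hπ hb hcong
  have hπm : π ∈ maximalIdeal R := (IsLocalRing.mem_maximalIdeal _).mpr hπ.not_unit
  have hvπ : O.valuation (π : K) < 1 := (hval π).mp hπm
  refine hN g₀ π u₀ g₀.2 π.2 u₀.2 hvπ ?_
  have e := congrArg Subtype.val hglob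
  simpa [hfRdef, Subring.coe_mul, Subring.coe_pow, Subring.coe_add] using e

end Summit.ResolutionOfSingularities.ResolutionOfSingularities.Theorems.SwitchingDichotomy.NoSingularCarrier

end
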